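import Summits.BirchSwinnertonDyer.BirchSwinnertonDyer.Theorems.GenusKolyvaginAtTwoTorsionCellSELNegTwistCount
import Summits.BirchSwinnertonDyer.BirchSwinnertonDyer.Theorems.GenusKolyvaginAtTwoTorsionCellSELIsoClassLawC0
import HarnessLib

/-!
# SEL (iso-class Selmer pair law), C1-R: the `C₁` conjunct from the full base setting, and LINE 49's stub SEL unfolded

Crux R″ `RankOneTwoTorsionResidualAtTwo` (stmt-27478), LINE 49 «torsion_cell_full_vertex_bsdidea1», SUPPORT stub
`IsoClassSelmerPairLawAtTwo` (skeleton v1.4.3 §2 SEL).  This file discharges the bookkeeping between the line's hypotheses —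
`FullBaseSetting` (full rational `2`-torsion, `Ш(E₀)[2] = 0`, `p₀ ≡ 7 (mod 8)` with every `ℓ ∣ 2N₀` split in `ℚ(√−p₀)`,
full-admissible `Q₀ ∌ p₀` with `∏ q* > 0`), `IsIsoClass N₀ Q₀`, `IsGenusPair` (a model `C₁ = T • E₀^{(−p₀M₀)}`) — and the
symbol-form count `natCard_selmerGroup_negTwist_isoClass_eq` of part C1-Q:

* `isoClassSelmerLaw_C₁` — `#C₁(ℚ)[2] = 4 ∧ #Sel⁽²⁾(C₁/ℚ) = 8 · #ker Φ₃(borderedLaplacian Q₀ p₀)`, every even `#Q₀`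
  (including `Q₀ = ∅`: `#Sel⁽²⁾(E₀^{(−p₀)}) = 8`, empty matrix);
* `isoClassSelmerPairLaw_unfolded` — LINE 49's `IsoClassSelmerPairLawAtTwo` with the line's `def`s replaced by their bodies
  verbatim: the `C₀` conjunct (`isoClassSelmerLaw_C₀`, part V-f) AND the `C₁` conjunct.  In the hosted skeleton the stub becomes
  `fun E₀ _ _ _ Dt p₀ Q₀ C₀ _ C₁ _ => isoClassSelmerPairLaw_unfolded E₀ Dt p₀ Q₀ C₀ C₁`.

Everything is proved (GW-free, parity-free); no LINE 49 statement is restated; BSD is not advanced by this file alone.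

## References

* [ShuZhai2021] J. Shu, S. Zhai, Trans. AMS 374 (2021), Def. 1.1, Thm. 1.2.
* [KlagsbrunMazurRubin2013] Z. Klagsbrun, B. Mazur, K. Rubin, Ann. of Math. 178 (2013), Thm. 3.9.
* [Kane2013SelmerTwists] D. M. Kane, Algebra Number Theory 7 (2013), §2.
* [SilvermanAEC2009] J. H. Silverman, *The Arithmetic of Elliptic Curves*, 2nd ed., Prop. X.1.4, Thm. X.4.2.
-/

noncomputable section

open scoped Classical

namespace Summit.BirchSwinnertonDyer.BirchSwinnertonDyer.Theorems.GenusKolyvaginAtTwo.TorsionCellSEL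

open WeierstrassCurve WeierstrassCurve.Affine WeierstrassCurve.Affine.Point
open Literature.NumberTheory.GaloisRepresentations Literature.NumberTheory.EllipticCurves Field
open Literature.NumberTheory.EllipticCurves.TwoDescentLocal
open Literature.NumberTheory.EllipticCurves.KramerTwoDescent
open Literature.NumberTheory.EllipticCurves.ShuZhai2021 (qStar IsInertInSqrt AllPrimesSplitInSqrt IsOptimalDatum
  CuspZeroNotInTwice)
open Literature.NumberTheory.EllipticCurves.ModularForms (ModularParametrizationData)
open Summit.BirchSwinnertonDyer.BirchSwinnertonDyer.Theorems.GenusKolyvaginAtTwo.TorsionCellD0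
open Summit.BirchSwinnertonDyer.BirchSwinnertonDyer.Theorems.GenusKolyvaginAtTwo.FullVertex
open IsDedekindDomain NumberField Rat.HeightOneSpectrum Matrix

section C1

variable (E₀ : WeierstrassCurve ℚ) [E₀.IsElliptic] [E₀.IsGloballyMinimal]

/-- **THE `C₁` CONJUNCT OF THE ISO-CLASS SELMER PAIR LAW** (LINE 49 SEL, second half): `E₀/ℚ` globally minimal with two
independent rational `2`-torsion points, rank `0`, `Ш(E₀)[2] = 0`; `p₀ ≡ 7 (mod 8)` prime with every `ℓ ∣ 2N₀` split in
`ℚ(√−p₀)`; `Q₀ ∌ p₀` a finite set of full-admissible primes with `∏ q* > 0`, ISO-CLASS relative to `N₀`.  Then every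
model `C₁ = T • E₀^{(−p₀ ∏ q*)}` has `#C₁(ℚ)[2] = 4` and `#Sel⁽²⁾(C₁/ℚ) = 8 · #ker Φ₃(borderedLaplacian Q₀ p₀)`.
[cite: ShuZhai2021, Def. 1.1, Thm. 1.2] [cite: KlagsbrunMazurRubin2013, Thm. 3.9] [cite: Kane2013SelmerTwists, §2] -/
theorem isoClassSelmerLaw_C₁ [inst : DecidableEq ℚ] (hN : E₀.conductorNorm ℤ ≠ 0)
    {P R : E₀.toAffine.Point} (hPR : P ≠ R) (hP0 : P ≠ 0) (hR0 : R ≠ 0) (hP2 : (2 : ℕ) • P = 0) (hR2 : (2 : ℕ) • R = 0)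
    (hrank : E₀.mordellWeilRank = 0) (hsha : ∀ x ∈ E₀.sha, (2 : ℕ) • x = 0 → x = 0)
    {p₀ : ℕ} (hp : p₀.Prime) (hp8 : p₀ % 8 = 7) (hsplitp : AllPrimesSplitInSqrt (2 * E₀.conductorNorm ℤ) (-(p₀ : ℤ)))
    {Q₀ : Finset ℕ}
    (hadm : ∀ q ∈ Q₀, (q.Prime ∧ Nat.Coprime q (2 * E₀.conductorNorm ℤ) ∧
      ∀ (V : WeierstrassCurve ℚ) [V.IsElliptic], (∃ φ : Isogeny E₀ V, φ.degree = 2) → IsInertInSqrt q V.Δ) ∧ q ≠ p₀)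
    (hpos : 0 < ∏ q ∈ Q₀, qStar q) (hiso : IsIsoClass (E₀.conductorNorm ℤ) Q₀)
    {C₁ : WeierstrassCurve ℚ}
    (hC₁ : ∃ T : VariableChange ℚ, T • E₀.quadraticTwist ((-(p₀ : ℤ) * ∏ q ∈ Q₀, qStar q : ℤ) : ℚ) = C₁) :
    Nat.card (AddSubgroup.torsionBy C₁.toAffine.Point ((2 : ℕ) : ℤ)) = 4 ∧
      Nat.card (C₁.selmerGroup ((2 : ℕ) : ℤ)) = 8 * Nat.card (LinearMap.ker (phi3 (borderedLaplacian Q₀ p₀)).mulVecLin) := by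
  have e : inst = fun a b => Classical.propDecidable (a = b) := Subsingleton.elim _ _
  subst e
  have h22 : ((2 : ℕ) : ℤ) = 2 := rfl
  haveI hpF : Fact p₀.Prime := ⟨hp⟩
  obtain ⟨a₁, a₂, a₃, habc⟩ := exists_splitTwoTorsion_of_two_torsion_points E₀ hPR hP0 hR0 hP2 hR2
  obtain ⟨e₁, e₂, e₃, h12, h23, h⟩ := exists_splitTwoTorsion_lt habc
  have hp2 : p₀ ≠ 2 := by rintro rfl; norm_num at hp8
  have hp4 : p₀ % 4 = 3 := by omega
  have hp0 : (p₀ : ℚ) ≠ 0 := by exact_mod_cast hp.ne_zero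
  -- the primes of `Q₀`
  have hQ : ∀ q ∈ Q₀, q.Prime := fun q hq => (hadm q hq).1.1
  have hQ4 : ∀ q ∈ Q₀, q % 4 = 3 := fun q hq =>
    emod_four_eq_three_of_fullAdmissible E₀ (inst := _) hPR hP0 hR0 hP2 hR2 (hadm q hq).1.1 (hadm q hq).1.2.1 (hadm q hq).1.2.2
  have hk : Even Q₀.card := even_card_of_prod_qStar_pos hQ hQ4 hpos
  have hdQ : ((∏ q ∈ Q₀, qStar q : ℤ) : ℚ) = ∏ q ∈ Q₀, (q : ℚ) := cast_prod_qStar_eq hQ4 hk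
  have hd : ((-(p₀ : ℤ) * ∏ q ∈ Q₀, qStar q : ℤ) : ℚ) = -(p₀ : ℚ) * ∏ q ∈ Q₀, (q : ℚ) := by
    rw [Int.cast_mul, hdQ]; push_cast; ring
  have hQ0 : ∀ q ∈ Q₀, (q : ℚ) ≠ 0 := fun q hq => by exact_mod_cast (hQ q hq).ne_zero
  have hd0 : -(p₀ : ℚ) * ∏ q ∈ Q₀, (q : ℚ) ≠ 0 := mul_ne_zero (neg_ne_zero.mpr hp0) (Finset.prod_ne_zero_iff.mpr hQ0)
  rw [hd] at hC₁
  obtain ⟨T, rfl⟩ := hC₁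
  refine ⟨natCard_torsionBy_two_smul_quadraticTwist E₀ (inst := _) h hd0 T, ?_⟩
  rw [natCard_selmerGroup_smul_quadraticTwist E₀ hd0, h22]
  -- `Q₀ = ∅`: `#Sel(E₀^{(−p₀)}) = 8`, empty matrix
  by_cases hQe : Q₀ = ∅
  · subst hQe
    have hker : Nat.card (LinearMap.ker (phi3 (borderedLaplacian (∅ : Finset ℕ) p₀)).mulVecLin) = 1 :=
      (card_ker_mulVecLin_eq_one_iff_det_eq_one _).mpr (Matrix.det_eq_one_of_card_eq_zero (by simp))
    rw [hker, mul_one]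
    have h1 : -(p₀ : ℚ) * ∏ q ∈ (∅ : Finset ℕ), (q : ℚ) = -(p₀ : ℚ) := by rw [Finset.prod_empty, mul_one]
    haveI : (E₀.quadraticTwist (-(p₀ : ℚ))).IsElliptic := E₀.isElliptic_quadraticTwist (neg_ne_zero.mpr hp0)
    rw [h1]
    exact natCard_selmerGroup_negPrime_twist_eq_eight_of_base E₀ (inst := _) hN hPR hP0 hR0 hP2 hR2 hrank hsha hp8 hsplitp
  -- `Q₀ ≠ ∅`: the symbol-form count of part C1-Q
  obtain ⟨q₀, hq₀⟩ := Finset.nonempty_iff_ne_empty.mpr hQe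
  set S : Finset ℕ := (2 * E₀.conductorNorm ℤ).primeFactors with hSdef
  have hS : ∀ ℓ ∈ S, ℓ.Prime := fun _ hℓ => Nat.prime_of_mem_primeFactors hℓ
  have h2S : 2 ∈ S := Nat.mem_primeFactors.mpr ⟨Nat.prime_two, dvd_mul_right 2 _, mul_ne_zero two_ne_zero hN⟩
  have hgood : ∀ ℓ : ℕ, (hℓ : ℓ.Prime) → ℓ ∉ S → haveI : Fact ℓ.Prime := ⟨hℓ⟩;
      padicValRat ℓ (e₁ - e₂) = 0 ∧ padicValRat ℓ (e₁ - e₃) = 0 ∧ padicValRat ℓ (e₂ - e₃) = 0 :=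
    fun ℓ hℓ hℓS => padicValRat_sub_roots_eq_zero_of_not_mem_primeFactors E₀ h hN ℓ hℓ hℓS
  have hNS : ∀ ℓ : ℕ, ℓ.Prime → ℓ ∉ S → ¬ ℓ ∣ E₀.conductorNorm ℤ := by
    intro ℓ hℓ hℓS hdvd
    exact hℓS (Nat.mem_primeFactors.mpr ⟨hℓ, Dvd.dvd.mul_left hdvd 2, mul_ne_zero two_ne_zero hN⟩)
  have hQS : ∀ q ∈ Q₀, q ∉ S := by
    intro q hq hqS
    exact (hQ q hq).ne_one (Nat.Coprime.eq_one_of_dvd (hadm q hq).1.2.1 (Nat.dvd_of_mem_primeFactors hqS))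
  -- the prime `p₀` in symbols
  obtain ⟨hpS, hsplit⟩ := negPrime_symbols_of_allPrimesSplitInSqrt hp hp2 hsplitp
  have hp₀Q : p₀ ∉ Q₀ := fun hpQ => (hadm p₀ hpQ).2 rfl
  -- iso-class in pairwise symbol form
  have hiso8 : ∀ q ∈ Q₀, ∀ q' ∈ Q₀, q % 8 = q' % 8 := fun q hq q' hq' => (hiso q hq q' hq').1
  have hisoS : ∀ q ∈ Q₀, ∀ q' ∈ Q₀, ∀ ℓ ∈ S, (hℓ : ℓ.Prime) → ℓ ≠ 2 → haveI : Fact ℓ.Prime := ⟨hℓ⟩;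
      legendreSym ℓ ((q : ℤ) * q') = 1 := by
    intro q hq q' hq' ℓ hℓS hℓ hℓ2
    haveI : Fact ℓ.Prime := ⟨hℓ⟩
    have hℓN : ℓ ∈ (E₀.conductorNorm ℤ).primeFactors := by
      have hdvd := Nat.dvd_of_mem_primeFactors hℓS
      have : ℓ ∣ E₀.conductorNorm ℤ := by
        rcases (Nat.Prime.dvd_mul hℓ).mp hdvd with h2 | hN'
        · exact absurd ((Nat.prime_dvd_prime_iff_eq hℓ Nat.prime_two).mp h2) hℓ2
        · exact hN'
      exact Nat.mem_primeFactors.mpr ⟨hℓ, this, hN⟩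
    have hj := (hiso q hq q' hq').2 ℓ hℓN hℓ2
    have hℓq' : ¬ ℓ ∣ q' := fun hd' => hQS q' hq' (((Nat.prime_dvd_prime_iff_eq hℓ (hQ q' hq')).mp hd') ▸ hℓS)
    have h0' : ((q' : ℤ) : ZMod ℓ) ≠ 0 := by
      rw [Ne, ZMod.intCast_zmod_eq_zero_iff_dvd]; exact_mod_cast hℓq'
    rw [← jacobiSym.legendreSym.to_jacobiSym, ← jacobiSym.legendreSym.to_jacobiSym, neg_eq_neg_one_mul (q : ℤ),
      neg_eq_neg_one_mul (q' : ℤ), legendreSym.mul, legendreSym.mul] at hj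
    have hm1 : legendreSym ℓ (-1) ≠ 0 := by
      have h10 : ((-1 : ℤ) : ZMod ℓ) ≠ 0 := by
        rw [Int.cast_neg, Int.cast_one]; exact neg_ne_zero.mpr one_ne_zero
      rcases legendreSym.eq_one_or_neg_one ℓ h10 with h1 | h1 <;> rw [h1] <;> decide
    have heq : legendreSym ℓ q = legendreSym ℓ q' := mul_left_cancel₀ hm1 hj
    rw [legendreSym.mul, heq]
    rcases legendreSym.eq_one_or_neg_one ℓ h0' with h1 | h1 <;> rw [h1] <;> norm_num
  -- full admissibility in residue bits and the common bit
  obtain ⟨n₁, hn₁⟩ := exists_intCast_eq_four_mul_root E₀ h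
  obtain ⟨n₂, hn₂⟩ := exists_intCast_eq_four_mul_root E₀ h.swap₁₂
  obtain ⟨n₃, hn₃⟩ := exists_intCast_eq_four_mul_root E₀ h.swap₂₃.swap₁₂
  have hadm' : ∀ q ∈ Q₀, (hq : q.Prime) → haveI : Fact q.Prime := ⟨hq⟩;
      qrBit q ((e₁ - e₂) * (e₁ - e₃)) = 1 ∧ qrBit q ((e₂ - e₁) * (e₂ - e₃)) = 1 := by
    intro q hq hqp
    haveI : Fact q.Prime := ⟨hqp⟩
    have hq2 : q ≠ 2 := fun h2 => hQS q hq (h2 ▸ h2S)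
    obtain ⟨g12, g13, g23⟩ := hgood q hqp (hQS q hq)
    obtain ⟨h₁, h₂, -⟩ := qrBit_delta_eq_one_of_forall_isogeny E₀ h hq2 hn₁ hn₂ hn₃ g12 g13 g23 (hadm q hq).1.2.2
    exact ⟨h₁, h₂⟩
  haveI hq₀F : Fact q₀.Prime := ⟨hQ q₀ hq₀⟩
  have hε : ∀ q ∈ Q₀, (hq : q.Prime) → haveI : Fact q.Prime := ⟨hq⟩; qrBit q (e₂ - e₁) = qrBit q₀ (e₂ - e₁) := by
    intro q hq hqp
    haveI : Fact q.Prime := ⟨hqp⟩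
    refine qrBit_sub_roots_eq_of_intCast hn₁ hn₂ h.ne₁₂ S h2S (fun ℓ hℓ hℓS => (hgood ℓ hℓ hℓS).1)
      (by rw [qrBit_neg_one_eq_one_of_emod_four (hQ4 q hq), qrBit_neg_one_eq_one_of_emod_four (hQ4 q₀ hq₀)]) ?_
    intro ℓ hℓ
    have := qrBit_kernel_eq_of_isoClass S Q₀ hS hQS hQ4 hiso8 hisoS hq hq₀ (Finset.singleton_subset_iff.mpr hℓ)
      (ε := 1) (Or.inl rfl)
    simpa using this
  -- the positive root differences are squares mod `p₀` (positive `S`-units; `−p₀` splits at `S`, `p₀ ≡ 7 (mod 8)`)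
  have hres : ∀ {x : ℚ} (hx : 0 < x), (∀ ℓ : ℕ, (hℓ : ℓ.Prime) → ℓ ∉ S → haveI : Fact ℓ.Prime := ⟨hℓ⟩; parityBit ℓ x = 0) →
      qrBit p₀ x = 0 := by
    intro x hx hpar
    have := qrBit_p₀_eq_signBit S hS hpS hp8 hsplit (Units.mk0 x hx.ne') (fun ℓ hℓ hℓS => by
      rw [Units.val_mk0]; exact hpar ℓ hℓ hℓS)
    rw [Units.val_mk0] at this
    rw [this]; exact (signBit_eq_zero_iff hx.ne').mpr hx
  have hpar : ∀ ℓ : ℕ, (hℓ : ℓ.Prime) → ℓ ∉ S → haveI : Fact ℓ.Prime := ⟨hℓ⟩;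
      parityBit ℓ (e₂ - e₁) = 0 ∧ parityBit ℓ (e₃ - e₁) = 0 ∧ parityBit ℓ (e₃ - e₂) = 0 := by
    intro ℓ hℓ hℓS
    haveI : Fact ℓ.Prime := ⟨hℓ⟩
    obtain ⟨g12, g13, g23⟩ := hgood ℓ hℓ hℓS
    refine ⟨?_, ?_, ?_⟩
    · rw [parityBit, ← neg_sub, padicValRat.neg, g12, Int.cast_zero]
    · rw [parityBit, ← neg_sub, padicValRat.neg, g13, Int.cast_zero]
    · rw [parityBit, ← neg_sub, padicValRat.neg, g23, Int.cast_zero]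
  have hres₀ : qrBit p₀ (e₂ - e₁) = 0 ∧ qrBit p₀ (e₃ - e₁) = 0 ∧ qrBit p₀ (e₃ - e₂) = 0 :=
    ⟨hres (sub_pos.mpr h12) fun ℓ hℓ hℓS => (hpar ℓ hℓ hℓS).1,
      hres (sub_pos.mpr (h12.trans h23)) fun ℓ hℓ hℓS => (hpar ℓ hℓ hℓS).2.1,
      hres (sub_pos.mpr h23) fun ℓ hℓ hℓS => (hpar ℓ hℓ hℓS).2.2⟩
  -- the count of part C1-Q
  haveI : (E₀.quadraticTwist (-(p₀ : ℚ) * ∏ q ∈ Q₀, (q : ℚ))).IsElliptic := E₀.isElliptic_quadraticTwist hd0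
  exact natCard_selmerGroup_negTwist_isoClass_eq E₀ S Q₀ h h12 h23 hS h2S hgood hNS hrank hsha hQ hQS hQ4 hk hq₀ hiso8 hisoS
    hadm' hε hpS hp₀Q hp8 hsplit hres₀ rfl

end C1

/-! ## LINE 49's stub SEL with the line's definitions unfolded -/

section Unfolded

/-- **`IsoClassSelmerPairLawAtTwo`, unfolded.**  LINE 49's stub SEL with its `def`s `FullBaseSetting` /
`HasFullRationalTwoTorsion` / `ShaTwoTrivial` / `IsFullAdmissible` / `IsGenusPair` replaced by their bodies verbatim (the
optimal-datum conjuncts, `3 < p₀` and `AllPrimesSplitInSqrt (2N₀) (∏ q*)` are carried but not used); `IsIsoClass`,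
`redeiLaplacian`, `borderedLaplacian`, `phi3` are the TREE definitions of `…FullVertexDefs`.  In the hosted skeleton:
`theorem stub_isoClassSelmerPairLaw : IsoClassSelmerPairLawAtTwo := fun E₀ _ _ _ Dt p₀ Q₀ C₀ _ C₁ _ =>
isoClassSelmerPairLaw_unfolded E₀ Dt p₀ Q₀ C₀ C₁`.
[cite: ShuZhai2021, Def. 1.1, Thm. 1.2] [cite: KlagsbrunMazurRubin2013, Thm. 3.9] [cite: Kane2013SelmerTwists, §2] -/
theorem isoClassSelmerPairLaw_unfolded [inst : DecidableEq ℚ]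
    (E₀ : WeierstrassCurve ℚ) [E₀.IsElliptic] [E₀.IsGloballyMinimal] [NeZero (E₀.conductorNorm ℤ)]
    (Dt : ModularParametrizationData E₀ (E₀.conductorNorm ℤ)) (p₀ : ℕ) (Q₀ : Finset ℕ)
    (C₀ : WeierstrassCurve ℚ) [C₀.IsElliptic] (C₁ : WeierstrassCurve ℚ) [C₁.IsElliptic] :
    ((∃ P Q : E₀.toAffine.Point, P ≠ Q ∧ P ≠ 0 ∧ Q ≠ 0 ∧ 2 • P = 0 ∧ 2 • Q = 0) ∧
      (∀ x ∈ E₀.sha, (2 : ℕ) • x = 0 → x = 0) ∧ IsOptimalDatum E₀ Dt ∧ ¬ (2 : ℤ) ∣ Dt.c ∧ CuspZeroNotInTwice E₀ Dt ∧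
      p₀.Prime ∧ 3 < p₀ ∧ p₀ % 8 = 7 ∧ AllPrimesSplitInSqrt (2 * E₀.conductorNorm ℤ) (-(p₀ : ℤ)) ∧
      (∀ q ∈ Q₀, (q.Prime ∧ Nat.Coprime q (2 * E₀.conductorNorm ℤ) ∧
        ∀ (V' : WeierstrassCurve ℚ) [V'.IsElliptic], (∃ φ : Isogeny E₀ V', φ.degree = 2) → IsInertInSqrt q V'.Δ) ∧
          q ≠ p₀) ∧
      0 < (∏ q ∈ Q₀, qStar q) ∧ AllPrimesSplitInSqrt (2 * E₀.conductorNorm ℤ) (∏ q ∈ Q₀, qStar q)) →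
    E₀.mordellWeilRank = 0 → IsIsoClass (E₀.conductorNorm ℤ) Q₀ →
    ((∃ T : VariableChange ℚ, T • E₀.quadraticTwist ((∏ q ∈ Q₀, qStar q : ℤ) : ℚ) = C₀) ∧
      (∃ T : VariableChange ℚ, T • E₀.quadraticTwist ((-(p₀ : ℤ) * ∏ q ∈ Q₀, qStar q : ℤ) : ℚ) = C₁)) →
    (Nat.card (AddSubgroup.torsionBy C₀.toAffine.Point ((2 : ℕ) : ℤ)) = 4 ∧
        Nat.card (C₀.selmerGroup ((2 : ℕ) : ℤ)) = 4 * Nat.card (LinearMap.ker (phi3 (redeiLaplacian Q₀)).mulVecLin)) ∧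
      (Nat.card (AddSubgroup.torsionBy C₁.toAffine.Point ((2 : ℕ) : ℤ)) = 4 ∧
        Nat.card (C₁.selmerGroup ((2 : ℕ) : ℤ)) = 8 * Nat.card (LinearMap.ker (phi3 (borderedLaplacian Q₀ p₀)).mulVecLin)) := by
  rintro ⟨⟨P, Q, hPQ, hP0, hQ0, hP2, hQ2⟩, hsha, -, -, -, hp, -, hp8, hsplitp, hadm, hpos, -⟩ hrank hiso ⟨hC₀, hC₁⟩
  exact ⟨isoClassSelmerLaw_C₀ E₀ (inst := _) (NeZero.ne _) hPQ hP0 hQ0 (by convert hP2) (by convert hQ2) hrank hsha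
      (fun q hq => (hadm q hq).1) hpos hiso hC₀,
    isoClassSelmerLaw_C₁ E₀ (inst := _) (NeZero.ne _) hPQ hP0 hQ0 (by convert hP2) (by convert hQ2) hrank hsha hp hp8 hsplitp
      hadm hpos hiso hC₁⟩

end Unfolded

end Summit.BirchSwinnertonDyer.BirchSwinnertonDyer.Theorems.GenusKolyvaginAtTwo.TorsionCellSEL

end
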